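import Summits.HodgeConjecture.HodgeConjecture.Theorems.VHCAbelianSchemesRoadNowhereDisplaceableDefs
import HarnessLib

/-!
# Road №4 (`VHCAbelianSchemesRoad`), crux stmt-HodgeConjecture-26512 `DiagLocalOfMarkmanPinnedForall` — lens line N′ «nowhere-displaceable»:
# the line's COMPOSITION `(N-F) → (N-I) → (N-U) → (S4)` on the Theorems lane (hypothesis form)

research route conditional on HC_CM; not a corollary; Q11.4-sentence-2 already refuted in dim ≥ 3.

FILE 4 of the req-51 plate (director-hodge g17 R17.29 (2), idea-crit-6 g4 N2-9, LEAD 165 l.5909: `Lines/birth.lean` imports NO Cruxes module, so the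
one-write bind of (S4) needs the composition on the Theorems lane). The two declarations below are BYTE-FOR-BYTE the sorry-free
`confinedLifts_of_lifts_of_upstairs` (workfile `Cruxes/DiagLocalOfMarkmanPinnedForall/Lines/NowhereDisplaceable.lean` c9299650b742f1b3 l.256) and
`properJumpCarrierExists_End_of_line` (l.322), read over the re-homed constants of `…Theorems.VHCAbelianSchemesRoadNowhereDisplaceableDefs`
(`ProperJump`, `quotientPullbackComplex`) and `…MoverTrapDefs` (`extJumpLocus`, `AdmTw'`, `EndTrivial`). HYPOTHESIS FORM: the three displayed
inputs (N-F) «jumps lift along `q`», (N-I) «confined lifts give a proper jump downstairs» (a tree theorem: `properJump_of_confinedLifts`, p673373),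
(N-U) «an upstairs proper-jump carrier at every End-trivial non-hyperelliptic H-good datum» enter as binders `hF hI hU`; NOTHING is asserted about
them, and nothing here says (S4) `stub_properJumpCarrierExists_End`, (c4a-E), the crux, №4, HC_AV, HC_CM or HC holds; HC_CM HELD, by name only;
typed ≠ proved. No `sorry`, no stub, no named fact. [cite: Markman2025SecantWeil, §9.3 Lemma 9.3.11] [cite: Mukai1978, §3] [cite: MumfordAV1970, §7 Thm. 4 (p. 72)]
-/

noncomputable section

open CategoryTheory CategoryTheory.Limits AlgebraicGeometry Topology

namespace Summit.HodgeConjecture.HodgeConjecture.Ring2.SemiregularRepresentatives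

set_option linter.dupNamespace false -- the cell's namespace repeats the summit name, as in every `Ring2*` file

namespace NowhereDisplaceable

open Literature.AlgebraicGeometry Literature.AlgebraicGeometry.Motives Literature.AlgebraicGeometry.Motives.AbelianVariety
open Literature.AlgebraicGeometry.HodgeTheory Literature.AlgebraicGeometry.Markman2025
open Literature.AlgebraicGeometry.KTheory (IsBoundedVBComplex)
open Literature.AlgebraicTopology.SingularHomology
open Summit.HodgeConjecture.HodgeConjecture.Ring2.SemiregularRepresentatives.MoverTrap

/-! ## §1 Jump descent, logic only -/

/-- **JUMP DESCENT, LOGIC ONLY**: if jumps lift along `q` (N-F at `E•`) and the jump locus of `q^*E•` lies in `{1} ∪ V(ℂ)` (the matrix of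
`ProperJump (J × Ĵ) (q^*E•)`), the hypothesis of (N-I) holds. [cite: MumfordAV1970, §7 Thm. 4 (p. 72)] -/
theorem confinedLifts_of_lifts_of_upstairs {D : SecantQuotientDatum} {E : CochainComplex D.Y.X.left.Modules ℤ}
    (hF : ∀ p : D.P.Points ℂ, AlgPoints.map D.q.hom.hom.hom p ∈ extJumpLocus D.Y E → p ∈ extJumpLocus D.P (quotientPullbackComplex D E))
    {V : SchemeOver ℂ} {ι : V ⟶ D.P.X}
    (hconf : extJumpLocus D.P (quotientPullbackComplex D E) ⊆ {1} ∪ Set.range (AlgPoints.map (L := ℂ) ι)) :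
    ∀ p : D.P.Points ℂ, AlgPoints.map D.q.hom.hom.hom p ∈ extJumpLocus D.Y E → p = 1 ∨ p ∈ Set.range (AlgPoints.map (L := ℂ) ι) :=
  fun p hp => by simpa only [Set.mem_union, Set.mem_singleton_iff] using hconf (hF p hp)

/-! ## §2 The composition `(N-F) → (N-I) → (N-U) → (S4)` -/

/-- **(S4) FROM THE RE-CUT**: `(N-F) → (N-I) → (N-U) → (S4)` VERBATIM (birth.lean v3.17 l.469 ∕ `Lines/MoverTrap.lean` rev 2 l.288, over p664145's vocabulary).
[cite: Markman2025SecantWeil, §9.3 Lemma 9.3.11] [cite: Mukai1978, §3] -/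
theorem properJumpCarrierExists_End_of_line
    (hF : ∀ (D : SecantQuotientDatum) (E : CochainComplex D.Y.X.left.Modules ℤ), IsBoundedVBComplex E →
      ∀ p : D.P.Points ℂ, AlgPoints.map D.q.hom.hom.hom p ∈ extJumpLocus D.Y E → p ∈ extJumpLocus D.P (quotientPullbackComplex D E))
    (hI : ∀ (D : SecantQuotientDatum) (E : CochainComplex D.Y.X.left.Modules ℤ)
      (V : SchemeOver ℂ) (ι : V ⟶ D.P.X), IsClosedImmersion ι.left →
      Set.range (AlgPoints.map (L := ℂ) ι) ≠ Set.univ →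
      (∀ p : D.P.Points ℂ, AlgPoints.map D.q.hom.hom.hom p ∈ extJumpLocus D.Y E → p = 1 ∨ p ∈ Set.range (AlgPoints.map (L := ℂ) ι)) →
      ProperJump D.Y E)
    (hU : ∀ (C : ChernCharacterBetti) (D : SecantQuotientDatum) (θ₀ : complexBetti D.𝒥.J.X 2),
      ¬ D.𝒥.IsHyperelliptic → OrbitTranslatesDisjoint D.𝒥 D.G₁ D.G₂ → D.𝒥.J.IsPolarizationClassOf D.Θ θ₀ → EndTrivial D →
      ∃ γ ∈ secantQuotientServedClassesPinned D.Y.X (D.hY θ₀), ∃ 𝓓 : PinnedTwistedDatum C AdmTw' D.Y.X (D.hY θ₀) γ,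
        ProperJump D.P (quotientPullbackComplex D 𝓓.E)) :
    ∀ (C : ChernCharacterBetti) (D : SecantQuotientDatum) (θ₀ : complexBetti D.𝒥.J.X 2),
      ¬ D.𝒥.IsHyperelliptic → OrbitTranslatesDisjoint D.𝒥 D.G₁ D.G₂ → D.𝒥.J.IsPolarizationClassOf D.Θ θ₀ → EndTrivial D →
      ∃ γ ∈ secantQuotientServedClassesPinned D.Y.X (D.hY θ₀), ∃ 𝓓 : PinnedTwistedDatum C AdmTw' D.Y.X (D.hY θ₀) γ,
        ∃ (V : SchemeOver ℂ) (ι : V ⟶ D.Y.X), IsClosedImmersion ι.left ∧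
          Set.range (AlgPoints.map (L := ℂ) ι) ≠ Set.univ ∧
          extJumpLocus D.Y 𝓓.E ⊆ {1} ∪ Set.range (AlgPoints.map (L := ℂ) ι) := by
  intro C D θ₀ hnh hH hθ₀ hEnd
  obtain ⟨γ, hγ, 𝓓, V, ι, hι, hV, hconf⟩ := hU C D θ₀ hnh hH hθ₀ hEnd
  exact ⟨γ, hγ, 𝓓, hI D 𝓓.E V ι hι hV (confinedLifts_of_lifts_of_upstairs (hF D 𝓓.E 𝓓.bounded) hconf)⟩

end NowhereDisplaceable

end Summit.HodgeConjecture.HodgeConjecture.Ring2.SemiregularRepresentatives
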